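import Summits.BirchSwinnertonDyer.Rank1Residual.Supersingular.MazurTateReduction
import HarnessLib

/-!
# Parity of `λ(θ_n)`: the algebraic lemmas
# (cell `b2b-bsdres`, supersingular family, prover B = unit `b2b-bsdres-additive-p3`, gen 5; part 2a)

HONEST FRAMING (run/shared/lean/b2b/bsd-rank1-residual/, verbatim in every file): the goal of the
cell is to DELETE the COMBINATION-SHAPED residual classes of the Birch–Swinnerton-Dyer formula for
ALL analytic-rank `≤ 1` elliptic curves over `ℚ` — "full BSD formula for every rank `≤ 1` curve in
class `C`" assembled STRICTLY from published theorems — so that the rank-`≤ 1` remainder becomes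
exactly the CONSTRUCTION-SHAPED classes, which are TYPED (missing-input `Prop`s), NOT attempted.
This is not "finishing BSD". THEOREMS ONLY (pure algebra; no definition, no named fact; nothing about
any curve is asserted; nothing booked; labels unchanged).

The mechanism behind `(−1)^{λ(θ_n)} = −ε_N(f)` (`MazurTateParity.lean`): over any commutative ring,
the coefficient of `X^λ` (`λ` = trailing degree of `θ`) in `(X+1)^c · θ((X+1)^{M−1} − 1)` is
`(M−1)^λ [X^λ]θ` (`coeff_natTrailingDegree_reflect`); so over a field, if
`X^M ∣ θ − σ (X+1)^c θ((X+1)^{M−1} − 1)` with `θ ≠ 0`, `deg θ < M`, then `σ (M−1)^λ = 1`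
(`mul_pow_natTrailingDegree_eq_one_of_dvd`). Plus bookkeeping: monic division descends along an
injective ring map (`dvd_of_map_dvd_map_of_injective`), `ord_T` of a polynomial as a power series is
its trailing degree, `ω_n ↦ (X+1)^{pⁿ} − 1` under any coefficient map, `(X+1)^m − 1` is monic,
`−1 ≠ 1` and `pⁿ − 1 = −1` in `𝔽_p` (`p` odd, `n ≥ 1`).

References: [Ota2018] K. Ota, Amer. J. Math. 140 (2018), Prop. 5.16, p. 498; [Pollack2003] Thm. 6.17.
-/

set_option autoImplicit false

noncomputable section

open scoped Classical

open Polynomial Literature.NumberTheory.EllipticCurves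

namespace Summit.BirchSwinnertonDyer.Rank1Residual.Supersingular

/-! ## §1. Pure algebra: the trailing coefficient under `θ ↦ (X+1)^c · θ((X+1)^{M−1} − 1)` -/

section Algebra

/-- **Trailing coefficient of the reflected polynomial.** Over any commutative ring `k`, for
`θ ∈ k[X]` with trailing degree `λ = natTrailingDegree θ`, `M ≥ 1` and any `c`, the coefficient of
`X^λ` in `(X+1)^c · θ((X+1)^{M−1} − 1)` is `(M − 1)^λ · [X^λ]θ`: write `θ = X^λ h`,
`(X+1)^{M−1} − 1 = X · Q` with `Q(0) = M − 1`, so the product is `X^λ · ((X+1)^c Q^λ h(XQ))` whose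
cofactor has constant term `(M−1)^λ h(0)`. [folklore] -/
theorem coeff_natTrailingDegree_reflect {k : Type*} [CommRing k] (θ : k[X]) (M : ℕ) (c : ℕ) :
    ((X + 1) ^ c * θ.comp ((X + 1) ^ (M - 1) - 1)).coeff θ.natTrailingDegree =
      ((M - 1 : ℕ) : k) ^ θ.natTrailingDegree * θ.coeff θ.natTrailingDegree := by
  set l := θ.natTrailingDegree with hl
  clear_value l
  -- `θ = X^l * h`, `h(0) = [X^l] θ`
  obtain ⟨h, hh⟩ : X ^ l ∣ θ :=
    X_pow_dvd_iff.mpr fun d hd ↦ coeff_eq_zero_of_lt_natTrailingDegree (hl ▸ hd)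
  have hh0 : h.coeff 0 = θ.coeff l := by
    rw [hh, coeff_X_pow_mul', if_pos le_rfl, Nat.sub_self]
  -- `(X+1)^{M-1} − 1 = X * Q`, `Q(0) = M − 1`
  set Q : k[X] := ((X + 1 : k[X]) ^ (M - 1) - 1).divX with hQ
  have hP0 : ((X + 1 : k[X]) ^ (M - 1) - 1).coeff 0 = 0 := by
    rw [coeff_sub, coeff_X_add_one_pow, coeff_one_zero, Nat.choose_zero_right, Nat.cast_one, sub_self]
  have hPQ : ((X + 1 : k[X]) ^ (M - 1) - 1) = X * Q := by
    have h := X_mul_divX_add ((X + 1 : k[X]) ^ (M - 1) - 1)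
    rw [hP0, C_0, add_zero] at h
    exact h.symm
  have hQ0 : Q.coeff 0 = ((M - 1 : ℕ) : k) := by
    rw [hQ, coeff_divX, zero_add, coeff_sub, coeff_X_add_one_pow, coeff_one, if_neg one_ne_zero,
      sub_zero, Nat.choose_one_right]
  rw [hPQ]
  have hexp : (X + 1 : k[X]) ^ c * θ.comp (X * Q) = X ^ l * ((X + 1) ^ c * Q ^ l * h.comp (X * Q)) := by
    rw [hh, mul_comp, X_pow_comp, mul_pow]
    ring
  rw [hexp, coeff_X_pow_mul', if_pos le_rfl, Nat.sub_self, mul_coeff_zero, mul_coeff_zero,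
    coeff_X_add_one_pow, Nat.choose_zero_right, Nat.cast_one, one_mul, coeff_zero_eq_eval_zero (Q ^ l),
    eval_pow, ← coeff_zero_eq_eval_zero, hQ0, coeff_zero_eq_eval_zero (h.comp (X * Q)), eval_comp,
    eval_mul, eval_X, zero_mul, ← coeff_zero_eq_eval_zero, hh0]

/-- **The parity mechanism.** Over a field `k`: if `θ ≠ 0` has `deg θ < M` and
`X^M ∣ θ − σ · (X+1)^c · θ((X+1)^{M−1} − 1)`, then `σ · (M−1)^λ = 1` with `λ` the trailing degree
of `θ` (compare the coefficients of `X^λ`, `λ < M`: `[X^λ]θ = σ (M−1)^λ [X^λ]θ` with `[X^λ]θ ≠ 0`).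
In characteristic `p` with `M = pⁿ`, `n ≥ 1`: `σ (−1)^λ = 1`. [folklore] -/
theorem mul_pow_natTrailingDegree_eq_one_of_dvd {k : Type*} [Field k] {θ : k[X]} (hθ : θ ≠ 0)
    {M : ℕ} (hdeg : θ.natDegree < M) {σ : k} {c : ℕ}
    (hdvd : X ^ M ∣ θ - C σ * ((X + 1) ^ c * θ.comp ((X + 1) ^ (M - 1) - 1))) :
    σ * ((M - 1 : ℕ) : k) ^ θ.natTrailingDegree = 1 := by
  obtain ⟨l, hl⟩ : ∃ l, θ.natTrailingDegree = l := ⟨_, rfl⟩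
  have hlM : l < M := hl ▸ lt_of_le_of_lt (natTrailingDegree_le_natDegree θ) hdeg
  have h0 := (X_pow_dvd_iff.mp hdvd) l hlM
  have hr := coeff_natTrailingDegree_reflect θ M c
  rw [hl] at hr
  rw [coeff_sub, coeff_C_mul, hr] at h0
  have ht : θ.coeff l ≠ 0 := by
    have h := mt trailingCoeff_eq_zero.mp hθ
    rwa [trailingCoeff, hl] at h
  have h1 : (1 - σ * ((M - 1 : ℕ) : k) ^ l) * θ.coeff l = 0 := by linear_combination h0
  rw [hl]
  rcases mul_eq_zero.mp h1 with h2 | h2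
  · linear_combination -h2
  · exact absurd h2 ht

/-- A divisibility by a MONIC polynomial can be checked after an injective base change: if
`q.map φ ∣ a.map φ` with `q` monic and `φ` injective then `q ∣ a` (division with remainder by `q`
commutes with `φ`). [folklore] -/
theorem dvd_of_map_dvd_map_of_injective {R S : Type*} [CommRing R] [CommRing S] (φ : R →+* S)
    (hφ : Function.Injective φ) {q a : R[X]} (hq : q.Monic) (h : q.map φ ∣ a.map φ) : q ∣ a := by
  rw [← modByMonic_eq_zero_iff_dvd hq]
  apply Polynomial.map_injective φ hφ
  rw [Polynomial.map_modByMonic φ hq, Polynomial.map_zero]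
  exact (modByMonic_eq_zero_iff_dvd (hq.map φ)).mpr h

/-- `ord_T` of a non-zero polynomial viewed as a power series is its trailing degree. [folklore] -/
theorem order_coe_eq_natTrailingDegree {k : Type*} [Field k] {q : k[X]} (hq : q ≠ 0) :
    (q : PowerSeries k).order = q.natTrailingDegree := by
  refine PowerSeries.order_eq_nat.mpr ⟨?_, fun i hi ↦ ?_⟩
  · rw [Polynomial.coeff_coe]
    have h := mt trailingCoeff_eq_zero.mp hq
    rwa [trailingCoeff] at h
  · rw [Polynomial.coeff_coe]
    exact coeff_eq_zero_of_lt_natTrailingDegree hi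

end Algebra

/-! ## §2. Bookkeeping over `ℤ_p` and `𝔽_p` -/

section Padic

variable {p : ℕ} [hp : Fact p.Prime]

omit hp in
/-- `ω_n` maps to `(X+1)^{pⁿ} − 1` under any coefficient map from `ℤ`. [cite: Pollack2003, Thm. 6.17] -/
theorem map_cyclotomicOmega {R : Type*} [CommRing R] (φ : ℤ →+* R) (n : ℕ) :
    (cyclotomicOmega p n).map φ = (X + 1 : R[X]) ^ p ^ n - 1 := by
  simp [cyclotomicOmega]

/-- `(X+1)^m − 1` is monic over any nontrivial commutative ring, `m ≥ 1`. [folklore] -/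
theorem monic_X_add_one_pow_sub_one {R : Type*} [CommRing R] [Nontrivial R] {m : ℕ} (hm : 1 ≤ m) :
    ((X + 1 : R[X]) ^ m - 1).Monic := by
  have h1 : (X + 1 : R[X]).Monic := monic_X_add_C 1
  have hm' : ((X + 1 : R[X]) ^ m).natDegree = m := by
    rw [← C_1, Polynomial.natDegree_pow_X_add_C]
  refine (h1.pow m).sub_of_left ?_
  rw [degree_one, degree_eq_natDegree (h1.pow m).ne_zero, hm']
  exact_mod_cast hm

/-- `−1 ≠ 1` in the residue field `𝔽_p` of `ℤ_p` for `p ≠ 2` (`PadicInt.residueField : 𝔽_p ≃ ℤ/p`).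
[folklore] -/
theorem neg_one_ne_one_residueField (hp2 : p ≠ 2) :
    (-1 : IsLocalRing.ResidueField ℤ_[p]) ≠ 1 := by
  intro h
  have h' := congrArg (PadicInt.residueField (p := p)) h
  rw [map_neg, map_one] at h'
  have h2 : ((2 : ℕ) : ZMod p) = 0 := by
    have : (2 : ZMod p) = 0 := by linear_combination -h'
    exact_mod_cast this
  have h3 : p ∣ 2 := (ZMod.natCast_eq_zero_iff 2 p).mp h2
  exact hp2 (le_antisymm (Nat.le_of_dvd two_pos h3) hp.out.two_le)

/-- `(pⁿ − 1 : ℕ) = −1` in `𝔽_p` for `n ≥ 1`. [folklore] -/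
theorem natCast_pow_sub_one_residueField {n : ℕ} (hn : n ≠ 0) :
    ((p ^ n - 1 : ℕ) : IsLocalRing.ResidueField ℤ_[p]) = -1 := by
  have hpn : 1 ≤ p ^ n := Nat.one_le_pow _ _ hp.out.pos
  have hp0 : (p : IsLocalRing.ResidueField ℤ_[p]) = 0 := by
    have h := intResidue_natCast_self (p := p)
    rwa [RingHom.comp_apply, map_natCast, map_natCast] at h
  rw [Nat.cast_sub hpn, Nat.cast_pow, hp0, zero_pow hn, Nat.cast_one, zero_sub]

end Padic

end Summit.BirchSwinnertonDyer.Rank1Residual.Supersingular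

end
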